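import Summits.Ventures.DiscreteObjects.Hadamard.QRBlocks167

/-!
# Hadamard 668 census — row F7: no two-circulant quaternary complex Hadamard matrix `CH(334)` with square-invariant first rows

Framing: lottery ticket; floor = certified bounds/negative ranges.

Cell pub-namedobj (venture DiscreteObjects), target (H).  A complex Hadamard matrix `C` of order `334` with entries in
`{±1, ±i}` gives, by Turyn's doubling `C = X + iY ↦ [[X+Y, X−Y], [−(X−Y), X+Y]]`, a real Hadamard matrix of order
`668`.  The two-circulant form `C = [[A, B], [−B*, A*]]` (`A, B` circulant with first rows `a, b : ZMod 167 → ℤ[i]`)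
satisfies `C C* = 334·I` iff the Hermitian periodic autocorrelations cancel: `CPAF_a(s) + CPAF_b(s) = 0` for all
`s ≠ 0`.  With the only proper multiplier symmetry available at the prime 167 — invariance of both first rows
under the non-zero squares `C₈₃ = ⟨4⟩` — each row is a three-valued block (`eq_blk` of `QRBlocks167`), its
`CPAF(1)` is one of nine Gaussian integers with real part `-1` or `≥ 81` (`cpaf_blk_one`, kernel evaluation of the
`4³ = 64` blocks), and no two of those cancel: the sub-family is EMPTY (`no_quaternary_pair_qr167`).  This is the
kernel certificate of TABLE-H row F7 (three exact enumerations in the cell agree: hadamard E1′ 0/4096, verify-ref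
E2, lead third engine; (+) control at v = 7: 128 pairs → CH(14) → H(28)).  Ours, not literature; no `sorry`,
no `native_decide`.
-/

open Finset BigOperators

namespace Summit.Ventures.DiscreteObjects.Hadamard

/-! ## Quaternary two-circulant complex Hadamard matrices `CH(334)` with square-invariant first rows -/

/-- Hermitian periodic autocorrelation of a Gaussian-integer sequence on `ZMod 167`:
`CPAF_x(s) = Σ_j x (j + s) · conj (x j)` (the `s`-th entry of the first row of `X X*` for the circulant `X`
with first row `x`) -/
def CPAF (x : ZMod 167 → GaussianInt) (s : ZMod 167) : GaussianInt := ∑ j, x (j + s) * star (x j)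

/-- the four quaternary units `1, -1, i, -i` of `ℤ[i]` -/
def quatUnits : List GaussianInt := [1, -1, ⟨0, 1⟩, ⟨0, -1⟩]

/-- the sequence is quaternary (`{±1, ±i}`-valued) -/
def IsQuat (x : ZMod 167 → GaussianInt) : Prop := ∀ j, x j ∈ quatUnits

/-- the nine values taken by `CPAF(1)` on the 64 square-invariant quaternary blocks of length 167 -/
def cpafValues : List GaussianInt :=
  [⟨-1, -2⟩, ⟨-1, 0⟩, ⟨-1, 2⟩, ⟨81, -2⟩, ⟨81, 2⟩, ⟨83, 0⟩, ⟨163, 0⟩, ⟨165, 0⟩, ⟨167, 0⟩]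

set_option maxRecDepth 100000 in
set_option maxHeartbeats 4000000 in
/-- kernel evaluation: `CPAF(1)` of each of the `4³ = 64` quaternary blocks lies in `cpafValues` -/
theorem cpaf_blk_one : ∀ e0 ∈ quatUnits, ∀ e1 ∈ quatUnits, ∀ e2 ∈ quatUnits,
    CPAF (blk e0 e1 e2) 1 ∈ cpafValues := by
  decide

/-- no two of the nine values cancel (real parts are `-1` or `≥ 81`) -/
theorem cpafValues_no_cancel : ∀ u ∈ cpafValues, ∀ w ∈ cpafValues, u + w ≠ 0 := by decide

/-- `CPAF(1)` of a square-invariant quaternary sequence on `ZMod 167` is one of the nine tabulated values -/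
theorem cpaf_one_of_inv4 (x : ZMod 167 → GaussianInt) (hx : IsQuat x) (hinv : ∀ i, x (4 * i) = x i) :
    CPAF x 1 ∈ cpafValues := by
  rw [eq_blk x hinv]
  exact cpaf_blk_one (x 0) (hx 0) (x 1) (hx 1) (x (-1)) (hx (-1))

/-- **Census row F7 (kernel certificate).** No pair `(a, b)` of quaternary (`±1, ±i`) sequences on `ZMod 167`,
both invariant under the non-zero squares `C₈₃ = ⟨4⟩`, satisfies `CPAF_a(s) + CPAF_b(s) = 0` for all `s ≠ 0`;
i.e. there is no two-circulant complex Hadamard matrix `[[A, B], [-B*, A*]]` of order 334 with such first rows,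
and hence no Hadamard matrix of order 668 from it by Turyn's doubling `X + iY ↦ [[X+Y, X−Y], [−(X−Y), X+Y]]`.
Already the shift `s = 1` fails. -/
theorem no_quaternary_pair_qr167 (a b : ZMod 167 → GaussianInt) (ha : IsQuat a) (hb : IsQuat b)
    (ia : ∀ i, a (4 * i) = a i) (ib : ∀ i, b (4 * i) = b i)
    (h : ∀ s : ZMod 167, s ≠ 0 → CPAF a s + CPAF b s = 0) : False :=
  cpafValues_no_cancel _ (cpaf_one_of_inv4 a ha ia) _ (cpaf_one_of_inv4 b hb ib) (h 1 (by decide))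

end Summit.Ventures.DiscreteObjects.Hadamard
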